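import Mathlib
import Literature.Computability.AlgebraicComplexity.PrattTrapezoidVal
import Literature.Computability.AlgebraicComplexity.PrattTrapezoidValBounds
import Summits.MatrixMultiplication.MatrixMultiplication.Theorems.SoloBlindPrattValCyclic

/-!
# Solo-blind seat, s42 (second file): `Val(ℤ/nℤ)/n → ∞` along ALL `n`

Companion to `SoloBlindPrattValCyclic.lean` (same session).  There `∀ M ∃ n, M·n ≤ Val(ℤ/nℤ)` was
certified (local strong USPs with coprime mixed moduli + CRT).  Here the conclusion is upgraded to
EVERY sufficiently large modulus — in particular to all large PRIMES, which carry no CRT structure —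
by a lifting lemma of the type of Pratt's Prop. 4.3(3) (arXiv:2309.03878, p. 9: `Val(ℤ_n) ≥
Val(ℤ_{n'})/2 − 1` for `n ≥ 6n'`), proved here directly for `n ≥ 3n'`:

* `soloVal_etf_lift` — an equilateral-trapezoid-free triple stays trapezoid-free under ANY three
  maps `f, g, k : G' → G` such that `f a + g b + k c = 0 ⟹ a + b + c = 0` on `A × B × C`;
* `soloVal_prattVal_zmod_le` — `Val(ℤ/n'ℤ) ≤ 2·Val(ℤ/nℤ) + 1` whenever `3n' ≤ n` (lift residues to
  `[0, n')`, translate the third set by `n − s·n'`, `s ∈ {1, 2}`; a zero sum in `ℤ/n'` has integer sum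
  `0`, `n'` or `2n'`);
* `soloVal_prattVal_zmod_eventually` — `∀ M ∃ N ∀ n ≥ N, M·n ≤ Val(ℤ/nℤ)` (tower of
  `SoloBlindPrattValCyclic` × a Bertrand prime, then the lift).

So Pratt's trivial bound `|G| ≤ Val(G)` (Prop. 3.4) is off by an unbounded factor for all large cyclic
groups, and Conjecture 4.1 (`Val(ℤ_n) ≤ n^{1+o(1)}`) is the strongest statement of its shape that can
hold up to the `o(1)`; pen version (SHARPEST §3 Q12): `Val(ℤ_n) ≥ n · exp(((2/3) ln 2 − o(1)) ln n / ln ln n)`.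

References: [Pratt2024] K. Pratt, arXiv:2309.03878, Def. 3.2, Props. 3.3–3.5, 4.3, Conj. 4.1.
-/

set_option linter.dupNamespace false

namespace Summit.MatrixMultiplication.MatrixMultiplication.Theorems

open Finset Literature.Computability.AlgebraicComplexity

section Lift

variable {G G' : Type*} [AddGroup G] [DecidableEq G] [AddGroup G'] [DecidableEq G']

omit [AddGroup G] [AddGroup G'] [DecidableEq G'] in
/-- One system of the trapezoid condition survives a lift `(f, g, k)` that reflects the relevant
relations. -/
private theorem soloVal_card_filter_lift_le_one {A B C : Finset G'} (f g k : G' → G)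
    (P' : G' × G' × G' → Prop) [DecidablePred P'] (P : G × G × G → Prop) [DecidablePred P]
    (hP : ∀ a ∈ A, ∀ b ∈ B, ∀ c ∈ C, P (f a, g b, k c) → P' (a, b, c))
    (h1 : #((A ×ˢ B ×ˢ C).filter P') ≤ 1) :
    #(((A.image f) ×ˢ (B.image g) ×ˢ (C.image k)).filter P) ≤ 1 := by
  refine Finset.card_le_one.2 fun t ht t' ht' => ?_
  simp only [mem_filter, mem_product, mem_image] at ht ht'
  obtain ⟨⟨⟨a, ha, hta⟩, ⟨b, hb, htb⟩, ⟨c, hc, htc⟩⟩, hPt⟩ := ht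
  obtain ⟨⟨⟨a2, ha2, hta2⟩, ⟨b2, hb2, htb2⟩, ⟨c2, hc2, htc2⟩⟩, hPt'⟩ := ht'
  have e : t = (f a, g b, k c) := Prod.ext hta.symm (Prod.ext htb.symm htc.symm)
  have e' : t' = (f a2, g b2, k c2) := Prod.ext hta2.symm (Prod.ext htb2.symm htc2.symm)
  have m1 : (a, b, c) ∈ (A ×ˢ B ×ˢ C).filter P' :=
    mem_filter.2 ⟨by simp [ha, hb, hc], hP a ha b hb c hc (e ▸ hPt)⟩
  have m2 : (a2, b2, c2) ∈ (A ×ˢ B ×ˢ C).filter P' :=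
    mem_filter.2 ⟨by simp [ha2, hb2, hc2], hP a2 ha2 b2 hb2 c2 hc2 (e' ▸ hPt')⟩
  have h12 := Finset.card_le_one.1 h1 _ m1 _ m2
  simp only [Prod.mk.injEq] at h12
  obtain ⟨rfl, rfl, rfl⟩ := h12
  rw [e, e']

/-- **Lifting lemma.**  If `f, g, k : G' → G` reflect zero sums on `A × B × C`
(`f a + g b + k c = 0 ⟹ a + b + c = 0`), then the image triple `(f(A), g(B), k(C))` of an
equilateral-trapezoid-free triple is equilateral trapezoid-free. -/
theorem soloVal_etf_lift {A B C : Finset G'} (h : IsEquilateralTrapezoidFree A B C)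
    (f g k : G' → G)
    (hK : ∀ a ∈ A, ∀ b ∈ B, ∀ c ∈ C, f a + g b + k c = 0 → a + b + c = 0) :
    IsEquilateralTrapezoidFree (A.image f) (B.image g) (C.image k) := by
  obtain ⟨h1, h2, h3⟩ := h
  refine ⟨fun x hx y hy => ?_, fun x hx y hy => ?_, fun x hx y hy => ?_⟩
  · obtain ⟨a', ha', rfl⟩ := mem_image.1 hx
    obtain ⟨b', hb', rfl⟩ := mem_image.1 hy
    exact soloVal_card_filter_lift_le_one f g k
      (fun t => a' + t.2.1 + t.2.2 = 0 ∧ t.1 + b' + t.2.2 = 0) _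
      (fun a ha b hb c hc ht => ⟨hK a' ha' b hb c hc ht.1, hK a ha b' hb' c hc ht.2⟩)
      (h1 a' ha' b' hb')
  · obtain ⟨a', ha', rfl⟩ := mem_image.1 hx
    obtain ⟨c', hc', rfl⟩ := mem_image.1 hy
    exact soloVal_card_filter_lift_le_one f g k
      (fun t => a' + t.2.1 + t.2.2 = 0 ∧ t.1 + t.2.1 + c' = 0) _
      (fun a ha b hb c hc ht => ⟨hK a' ha' b hb c hc ht.1, hK a ha b hb c' hc' ht.2⟩)
      (h2 a' ha' c' hc')
  · obtain ⟨b', hb', rfl⟩ := mem_image.1 hx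
    obtain ⟨c', hc', rfl⟩ := mem_image.1 hy
    exact soloVal_card_filter_lift_le_one f g k
      (fun t => t.1 + b' + t.2.2 = 0 ∧ t.1 + t.2.1 + c' = 0) _
      (fun a ha b hb c hc ht => ⟨hK a ha b' hb' c hc ht.1, hK a ha b hb c' hc' ht.2⟩)
      (h3 b' hb' c' hc')

omit [AddGroup G'] [DecidableEq G'] in
/-- Counting under a lift: the triples of `A × B × C` whose lifted sum vanishes inject into the
zero-sum triples of the image triple (when `f, g, k` are injective on `A, B, C`). -/
theorem soloVal_card_filter_le_card_zeroSumTriples_lift {A B C : Finset G'} (f g k : G' → G)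
    (hf : Set.InjOn f A) (hg : Set.InjOn g B) (hk : Set.InjOn k C) :
    #((A ×ˢ B ×ˢ C).filter fun t => f t.1 + g t.2.1 + k t.2.2 = 0) ≤
      #(zeroSumTriples (A.image f) (B.image g) (C.image k)) := by
  refine Finset.card_le_card_of_injOn (fun t => (f t.1, g t.2.1, k t.2.2)) ?_ ?_
  · intro t ht
    simp only [coe_filter, Set.mem_setOf_eq, mem_product] at ht
    obtain ⟨⟨ha, hb, hc⟩, hsum⟩ := ht
    simp only [mem_coe, mem_zeroSumTriples, mem_image]
    exact ⟨⟨⟨_, ha, rfl⟩, ⟨_, hb, rfl⟩, ⟨_, hc, rfl⟩⟩, hsum⟩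
  · intro t ht t' ht' htt
    simp only [coe_filter, Set.mem_setOf_eq, mem_product] at ht ht'
    simp only [Prod.mk.injEq] at htt
    obtain ⟨e1, e2, e3⟩ := htt
    exact Prod.ext (hf ht.1.1 ht'.1.1 e1) (Prod.ext (hg ht.1.2.1 ht'.1.2.1 e2)
      (hk ht.1.2.2 ht'.1.2.2 e3))

end Lift

section ZModLift

/-- Arithmetic of the lift `ℤ/n' → ℤ/n` by least residues, third coordinate shifted by `n − s·n'`
(`s ∈ {1,2}`, `3n' ≤ n`): the lifted sum vanishes in `ℤ/n` iff the residues add up to `s·n'`. -/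
theorem soloVal_lift_sum_eq_zero_iff {n' n : ℕ} [NeZero n'] [NeZero n] (h3 : 3 * n' ≤ n)
    {s : ℕ} (hs2 : s ≤ 2) (a b c : ZMod n') :
    ((a.val : ZMod n) + (b.val : ZMod n) + ((c.val + (n - s * n') : ℕ) : ZMod n) = 0) ↔
      a.val + b.val + c.val = s * n' := by
  have ha := a.val_lt
  have hb := b.val_lt
  have hc := c.val_lt
  have hn' : 0 < n' := Nat.pos_of_ne_zero (NeZero.ne n')
  have hcast : (a.val : ZMod n) + (b.val : ZMod n) + ((c.val + (n - s * n') : ℕ) : ZMod n) =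
      ((a.val + b.val + (c.val + (n - s * n')) : ℕ) : ZMod n) := by
    push_cast
    ring
  rw [hcast, CharP.cast_eq_zero_iff (ZMod n) n]
  constructor
  · rintro ⟨q, hq⟩
    have hs : s * n' ≤ 2 * n' := Nat.mul_le_mul_right _ hs2
    rcases q with _ | _ | q
    · omega
    · omega
    · have : 2 * n ≤ n * (q + 1 + 1) := by nlinarith
      omega
  · intro h
    have hs : s * n' ≤ 2 * n' := Nat.mul_le_mul_right _ hs2
    refine ⟨1, ?_⟩
    omega

/-- **`Val(ℤ/n'ℤ) ≤ 2·Val(ℤ/nℤ) + 1` for `3n' ≤ n`** (a Prop. 4.3(3)-type transfer, Pratt 2024). -/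
theorem soloVal_prattVal_zmod_le {n' n : ℕ} [NeZero n'] [NeZero n] (h3 : 3 * n' ≤ n) :
    prattVal (ZMod n') ≤ 2 * prattVal (ZMod n) + 1 := by
  obtain ⟨A, B, C, hE, hT⟩ := exists_prattVal_eq (G := ZMod n')
  rw [← hT]
  have hn' : 0 < n' := Nat.pos_of_ne_zero (NeZero.ne n')
  -- the lift maps
  set f : ZMod n' → ZMod n := fun x => (x.val : ZMod n) with hf
  have hfinj : Function.Injective f := by
    intro x y hxy
    apply ZMod.val_injective n'
    have h1 := congrArg ZMod.val hxy
    simp only [hf] at h1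
    rwa [ZMod.val_natCast_of_lt (x.val_lt.trans_le (by omega)),
      ZMod.val_natCast_of_lt (y.val_lt.trans_le (by omega))] at h1
  -- for s = 1, 2: the shifted third map and the count `T_s`
  have hstep : ∀ s : ℕ, 1 ≤ s → s ≤ 2 →
      #((A ×ˢ B ×ˢ C).filter fun t => t.1.val + t.2.1.val + t.2.2.val = s * n') ≤
        prattVal (ZMod n) := by
    intro s hs1 hs2
    set k : ZMod n' → ZMod n := fun x => ((x.val + (n - s * n') : ℕ) : ZMod n) with hk
    have hkinj : Function.Injective k := by
      intro x y hxy
      apply ZMod.val_injective n'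
      have h1 := congrArg ZMod.val hxy
      simp only [hk] at h1
      have hsn : n' ≤ s * n' := Nat.le_mul_of_pos_left _ hs1
      have hs2n : s * n' ≤ 2 * n' := Nat.mul_le_mul_right _ hs2
      have hx : x.val + (n - s * n') < n := by have := x.val_lt; omega
      have hy : y.val + (n - s * n') < n := by have := y.val_lt; omega
      rw [ZMod.val_natCast_of_lt hx, ZMod.val_natCast_of_lt hy] at h1
      omega
    have hK : ∀ a ∈ A, ∀ b ∈ B, ∀ c ∈ C, f a + f b + k c = 0 → a + b + c = 0 := by
      intro a _ b _ c _ habc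
      have hv := (soloVal_lift_sum_eq_zero_iff h3 hs2 a b c).1 habc
      have : ((a.val + b.val + c.val : ℕ) : ZMod n') = ((s * n' : ℕ) : ZMod n') := by rw [hv]
      simpa [ZMod.natCast_zmod_val, ZMod.natCast_self] using this
    have hEl : IsEquilateralTrapezoidFree (A.image f) (B.image f) (C.image k) :=
      soloVal_etf_lift hE f f k hK
    calc #((A ×ˢ B ×ˢ C).filter fun t => t.1.val + t.2.1.val + t.2.2.val = s * n')
        = #((A ×ˢ B ×ˢ C).filter fun t => f t.1 + f t.2.1 + k t.2.2 = 0) := by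
          congr 1
          refine filter_congr fun t _ => ?_
          exact (soloVal_lift_sum_eq_zero_iff h3 hs2 t.1 t.2.1 t.2.2).symm
      _ ≤ #(zeroSumTriples (A.image f) (B.image f) (C.image k)) :=
          soloVal_card_filter_le_card_zeroSumTriples_lift f f k (hfinj.injOn) (hfinj.injOn)
            (hkinj.injOn)
      _ ≤ prattVal (ZMod n) := card_zeroSumTriples_le_prattVal hEl
  -- split the zero-sum triples of (A, B, C) by the integer value of the residue sum
  have hsub : zeroSumTriples A B C ⊆
      ((A ×ˢ B ×ˢ C).filter fun t => t.1.val + t.2.1.val + t.2.2.val = 0) ∪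
      (((A ×ˢ B ×ˢ C).filter fun t => t.1.val + t.2.1.val + t.2.2.val = 1 * n') ∪
       ((A ×ˢ B ×ˢ C).filter fun t => t.1.val + t.2.1.val + t.2.2.val = 2 * n')) := by
    intro t ht
    rw [mem_zeroSumTriples] at ht
    obtain ⟨hmem, hsum⟩ := ht
    have hmem' : t ∈ A ×ˢ B ×ˢ C := by simp [mem_product, hmem.1, hmem.2.1, hmem.2.2]
    have hdvd : n' ∣ t.1.val + t.2.1.val + t.2.2.val := by
      rw [← CharP.cast_eq_zero_iff (ZMod n') n']
      push_cast
      simpa [ZMod.natCast_zmod_val] using hsum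
    have hlt : t.1.val + t.2.1.val + t.2.2.val < 3 * n' := by
      have := t.1.val_lt; have := t.2.1.val_lt; have := t.2.2.val_lt; omega
    obtain ⟨q, hq⟩ := hdvd
    simp only [mem_union, mem_filter, hmem', true_and]
    rcases q with _ | _ | _ | q
    · left; omega
    · right; left; omega
    · right; right; omega
    · exfalso
      have : 3 * n' ≤ n' * (q + 1 + 1 + 1) := by nlinarith
      omega
  have h0 : #((A ×ˢ B ×ˢ C).filter fun t => t.1.val + t.2.1.val + t.2.2.val = 0) ≤ 1 := by
    refine Finset.card_le_one.2 fun t ht t' ht' => ?_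
    simp only [mem_filter] at ht ht'
    have e1 : t.1.val = t'.1.val := by omega
    have e2 : t.2.1.val = t'.2.1.val := by omega
    have e3 : t.2.2.val = t'.2.2.val := by omega
    exact Prod.ext (ZMod.val_injective n' e1)
      (Prod.ext (ZMod.val_injective n' e2) (ZMod.val_injective n' e3))
  have h1 := hstep 1 le_rfl (by norm_num)
  have h2 := hstep 2 (by norm_num) le_rfl
  calc #(zeroSumTriples A B C)
      ≤ #(((A ×ˢ B ×ˢ C).filter fun t => t.1.val + t.2.1.val + t.2.2.val = 0) ∪
          (((A ×ˢ B ×ˢ C).filter fun t => t.1.val + t.2.1.val + t.2.2.val = 1 * n') ∪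
           ((A ×ˢ B ×ˢ C).filter fun t => t.1.val + t.2.1.val + t.2.2.val = 2 * n'))) :=
        card_le_card hsub
    _ ≤ 1 + (prattVal (ZMod n) + prattVal (ZMod n)) := by
        refine (card_union_le _ _).trans (Nat.add_le_add h0 ?_)
        exact (card_union_le _ _).trans (Nat.add_le_add h1 h2)
    _ = 2 * prattVal (ZMod n) + 1 := by ring

end ZModLift

/-- The analytic core of `soloVal_prattVal_zmod_eventually`: from one modulus `K` with
`5^t K ≤ 4^t Val(ℤ/K)` to every `n ≥ 6K² + 6K`, via a Bertrand prime and the lift. -/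
theorem soloVal_prattVal_zmod_eventually_aux {K t : ℕ} [NeZero K]
    (hK : 5 ^ t * K ≤ 4 ^ t * prattVal (ZMod K)) (n : ℕ) (hn : 6 * K * K + 6 * K ≤ n) :
    5 ^ t * (n + 1) ≤ 4 ^ t * (12 * (2 * prattVal (ZMod (n + 1)) + 1)) := by
  have hKpos : 0 < K := Nat.pos_of_ne_zero (NeZero.ne K)
  -- Euclidean division of `n + 1` by `6K`; quotient `x ≥ K`
  have hdm : 6 * K * ((n + 1) / (6 * K)) + (n + 1) % (6 * K) = n + 1 := Nat.div_add_mod _ _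
  have hml : (n + 1) % (6 * K) < 6 * K := Nat.mod_lt _ (by positivity)
  obtain ⟨x, hx⟩ : ∃ x, (n + 1) / (6 * K) = x := ⟨_, rfl⟩
  obtain ⟨r, hr⟩ : ∃ r, (n + 1) % (6 * K) = r := ⟨_, rfl⟩
  rw [hx, hr, Nat.mul_assoc] at hdm
  rw [hr] at hml
  have hn' : 6 * (K * K) + 6 * K ≤ n := by rwa [Nat.mul_assoc] at hn
  have hxK : K ≤ x := by
    by_contra hlt
    have h1 : 6 * (K * x) + 6 * K ≤ 6 * (K * K) :=
      calc 6 * (K * x) + 6 * K = 6 * (K * (x + 1)) := by ring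
        _ ≤ 6 * (K * K) := Nat.mul_le_mul_left _ (Nat.mul_le_mul_left K (by omega))
    omega
  have hx0 : x ≠ 0 := by omega
  -- a Bertrand prime `m ∈ (x, 2x]`; it exceeds `K`, hence is coprime to `K`
  obtain ⟨m, hm, hxm, hm2x⟩ := Nat.exists_prime_lt_and_le_two_mul x hx0
  have hcop : Nat.Coprime K m := by
    rw [Nat.coprime_comm, Nat.Prime.coprime_iff_not_dvd hm]
    intro hdvd
    exact absurd (Nat.le_of_dvd hKpos hdvd) (by omega)
  haveI : NeZero m := ⟨hm.ne_zero⟩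
  -- sizes: `3 K m ≤ n + 1 ≤ 12 K m`
  have hKm2 : K * m ≤ 2 * (K * x) :=
    calc K * m ≤ K * (2 * x) := Nat.mul_le_mul_left K hm2x
      _ = 2 * (K * x) := by ring
  have hKm1 : K * x + K ≤ K * m :=
    calc K * x + K = K * (x + 1) := by ring
      _ ≤ K * m := Nat.mul_le_mul_left K (Nat.succ_le_of_lt hxm)
  have h3 : 3 * (K * m) ≤ n + 1 := by omega
  have h12 : n + 1 ≤ 12 * (K * m) := by omega
  -- the chain `5^t K m ≤ 4^t Val(K)·m ≤ 4^t Val(K)·Val(m) ≤ 4^t Val(Km) ≤ 4^t (2 Val(n+1) + 1)`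
  have hmul := prattVal_zmod_mul_le (m := K) (n := m) hcop
  have hlift := soloVal_prattVal_zmod_le (n' := K * m) (n := n + 1) h3
  have hmV : m ≤ prattVal (ZMod m) := by
    have := card_le_prattVal (G := ZMod m)
    rwa [ZMod.card] at this
  have hchain : 5 ^ t * (K * m) ≤ 4 ^ t * (2 * prattVal (ZMod (n + 1)) + 1) :=
    calc 5 ^ t * (K * m) = 5 ^ t * K * m := by ring
      _ ≤ 4 ^ t * prattVal (ZMod K) * prattVal (ZMod m) := Nat.mul_le_mul hK hmV
      _ = 4 ^ t * (prattVal (ZMod K) * prattVal (ZMod m)) := by ring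
      _ ≤ 4 ^ t * prattVal (ZMod (K * m)) := Nat.mul_le_mul_left _ hmul
      _ ≤ 4 ^ t * (2 * prattVal (ZMod (n + 1)) + 1) := Nat.mul_le_mul_left _ hlift
  calc 5 ^ t * (n + 1) ≤ 5 ^ t * (12 * (K * m)) := Nat.mul_le_mul_left _ h12
    _ = 12 * (5 ^ t * (K * m)) := by ring
    _ ≤ 12 * (4 ^ t * (2 * prattVal (ZMod (n + 1)) + 1)) := Nat.mul_le_mul_left _ hchain
    _ = 4 ^ t * (12 * (2 * prattVal (ZMod (n + 1)) + 1)) := by ring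

/-- **`Val(ℤ/nℤ)/n → ∞` along all `n`:** for every `M` there is `N` such that `M·n ≤ Val(ℤ/nℤ)` for
every `n ≥ N` (stated with `n + 1` to carry the `NeZero` instance).  In particular
`Val(ℤ/pℤ) > p` for all sufficiently large primes `p` — moduli with no CRT structure at all. -/
theorem soloVal_prattVal_zmod_eventually (M : ℕ) :
    ∃ N : ℕ, ∀ n : ℕ, N ≤ n → M * (n + 1) ≤ prattVal (ZMod (n + 1)) := by
  -- a tower modulus `K = n₀ + 1` with `5^t K ≤ 4^t Val(ℤ/K)`, `t = 4 (M + 6)`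
  obtain ⟨n₀, hn₀⟩ := soloVal_tower (4 * (M + 6))
  -- `48 M · 4^t ≤ 5^t`
  have hM : 4 ^ (4 * (M + 6)) * (48 * M) ≤ 5 ^ (4 * (M + 6)) := by
    rw [pow_mul, pow_mul]
    norm_num
    have h48 : 48 * M ≤ 2 ^ (M + 6) := by
      have := (Nat.lt_two_pow_self (n := M)).le
      calc 48 * M ≤ 64 * 2 ^ M := by omega
        _ = 2 ^ (M + 6) := by ring
    calc 256 ^ (M + 6) * (48 * M) ≤ 256 ^ (M + 6) * 2 ^ (M + 6) := Nat.mul_le_mul_left _ h48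
      _ = 512 ^ (M + 6) := by rw [← mul_pow]; norm_num
      _ ≤ 625 ^ (M + 6) := Nat.pow_le_pow_left (by norm_num) _
  refine ⟨6 * (n₀ + 1) * (n₀ + 1) + 6 * (n₀ + 1), fun n hn => ?_⟩
  have haux := soloVal_prattVal_zmod_eventually_aux (K := n₀ + 1) (t := 4 * (M + 6)) hn₀ n hn
  -- `4^t · 48 M (n+1) ≤ 5^t (n+1) ≤ 4^t · 12 (2V + 1)`, cancel `4^t`
  have hfin : 4 ^ (4 * (M + 6)) * (48 * (M * (n + 1))) ≤
      4 ^ (4 * (M + 6)) * (12 * (2 * prattVal (ZMod (n + 1)) + 1)) :=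
    calc 4 ^ (4 * (M + 6)) * (48 * (M * (n + 1))) = 4 ^ (4 * (M + 6)) * (48 * M) * (n + 1) := by
          ring
      _ ≤ 5 ^ (4 * (M + 6)) * (n + 1) := Nat.mul_le_mul_right _ hM
      _ ≤ 4 ^ (4 * (M + 6)) * (12 * (2 * prattVal (ZMod (n + 1)) + 1)) := haux
  have hfin' := Nat.le_of_mul_le_mul_left hfin (by positivity)
  have hV : n + 1 ≤ prattVal (ZMod (n + 1)) := by
    have := card_le_prattVal (G := ZMod (n + 1))
    rwa [ZMod.card] at this
  omega

end Summit.MatrixMultiplication.MatrixMultiplication.Theorems
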